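/-
Copyright (c) 2026 the pub-hodgecm-mathlib formalisation cell (harness21).  Prover seat hodgecm-mathlib-K2Liu-p06 (g2): Track B «K2-LIT»,
#184♮ = hLiu418 = stmt-HodgeConjecture-24832; organ O33.3 for socket #33s `sig_K2LiuZetaSNonvanishingData` of the tier-1 socket module
`Cruxes/HLiu418/Lines/K2_Liu_CurveThetaSigs_U5d_ZetaS.lean` (ED. 2, sha16 658c80e5f6458509, :420; LEAD F0P6-plan (g10) RE-DEAL 2026-09-04T02:26:33Z); 2026-09-04.
-/
import Summits.HodgeConjecture.HodgeConjecture.Theorems.K2LiuSiegelEisensteinDoubledSummableReduction  -- ★ `norm_siegelDeltaCharacter`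
import Literature.NumberTheory.K2Lit.SiegelStandardSections                             -- ★ `IwasawaDatum`
import Summits.HodgeConjecture.HodgeConjecture.Theorems.K2LiuZetaSInnerProduct          -- ★ organ O33.2
import Summits.HodgeConjecture.HodgeConjecture.Theorems.K2LiuDoublingUnfoldBridge        -- ★ `exists_continuousMulEquiv_eq_iotaA`
import Mathlib.Analysis.SpecialFunctions.Pow.Continuity
import Mathlib.Analysis.SpecialFunctions.Pow.Complex
import HarnessLib

/-!
# Crux `HLiu418`, Track B road `K2_Liu`, unit U5d «`Z_S`», socket #33s — organ O33.3:
# the doubling weight `f_φ(x) = φ(ι(ιA x, 1))` of a continuous Siegel section is `L¹(G_∞ × G_S)` by the sharp height decay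

Cell `hodgecm-mathlib`, crux item hLiu418 = `stmt-HodgeConjecture-24832`, route of record `HCCMUnconditional`; squad K2 ∕ K2Liu,
LEAD F0P6-plan (g10), planner K2Liu-plan (g2), prover K2Liu-p06 (g2).  THEOREMS ONLY (no `def`, no instance, no notation, no
named-fact hypothesis, no `sorry`, default heartbeats); lane `--supports stmt-HodgeConjecture-24832` (count-neutral helper).

WHAT IS PROVED.  In the doubled unitary group `H(𝔸) = HA` with Siegel parabolic `P_Δ(𝔸)` (★ `IsSiegelDelta`), inducing character
`δ_{χ,s}(p) = χ(det_Δ p)|det_Δ p|^{s+n/2}` (★ `siegelDeltaCharacter`, `|det_Δ p|^{1/2} =` ★ `modDelta p`), an Iwasawa datum `𝒦` (★ `IwasawaDatum`: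
compact `K` with `H(𝔸) = P_Δ(𝔸)K`) and a continuous positive HEIGHT `Φ : H(𝔸) → ℝ`, `Φ(p x) = modDelta(p) Φ(x)` (the socket's `_hΦ`):
* (★ `norm_siegelDeltaCharacter` of `K2LiuSiegelEisensteinDoubledSummableReduction`: for UNITARY `χ`, `‖δ_{χ,s}(p)‖ = modDelta(p)^{2 Re s + n}`;)
* `exists_norm_section_le_height_rpow` — **section growth**: a CONTINUOUS Siegel section `φ` at `s` (★ `IsSiegelDeltaSection χ s φ`) satisfies
  `‖φ(h)‖ ≤ C · Φ(h)^{2 Re s + n}` on all of `H(𝔸)` (Iwasawa `h = p k`, `‖φ‖ Φ^{-(2 Re s + n)}` is continuous hence bounded on the compact `K`);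
* `continuous_iotaA` — the socket's transport `ιA` (conjugation by `toAdeleGL g`, hypothesis `_hιA`) is continuous (★ `exists_continuousMulEquiv_eq_iotaA`);
* `integrable_doublingWeight` — **`f_φ ∈ L¹(G_∞ × G_S, ν_∞ ⊗ ⊗_{v∈S} ν_v)`** as soon as `Φ(ι(ιA ·, 1))^{2 Re s + n}` is integrable there;
* `integrable_doublingWeight_of_decay` — in the socket's currency (`e : Fin N × Fin 1 ≃ Fin n`, so `n = N`;
  `_hs₀ : N/2 − 1 < Re s₀`; `_hdecay : ∀ τ > 2N − 2, Φ(…)^τ ∈ L¹`): the exponent `τ₀ = 2 Re s₀ + n` is admissible, so `f_φ ∈ L¹`;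
* `norm_integral_smul_rightRegular_le` — `‖∫ f(x) • R(p x) F‖ ≤ ‖f‖_{L¹} ‖F‖` (the `L¹`-continuity of the smear `f ↦ T_f F`, for O33.5);
* `exists_zetaS_translate_ne_zero_of_section` — O33.2 ★ `exists_zetaS_translate_ne_zero_of_continuous` with its `L¹` hypothesis DISCHARGED:
  for a continuous Siegel section `φ` at `s₀` and a continuous `φ₁` on the compact quotient, **`T_{f_φ}[φ₁] ≠ 0 ⇒ ∃ g₀, Z_S(φ, φ₁, φ₁(g₀•·)) ≠ 0`**.
This is step O33.3 of the #33s reduction (memo `K2/K2Liu-p06/g2/REPORT-FIRST-33s-ZetaSNonvanishingData.K2Liup06g2.md`); what remains for the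
socket is the CONSTRUCTION of an admissible `φ` (Siegel section at `s₀`, continuous, right-`K^S_H`-invariant, `𝒦`-finite) with `T_{f_φ}[φ₁] ≠ 0`
(organs O33.4–O33.7).

HONEST LABEL.  Count-neutral scaffold file of the K2_Liu road; it pays nothing by itself: `HC_CM` is proved only modulo the 7 printed citations
(2 remaining named inputs: hLiu418 = `stmt-HodgeConjecture-24832`, h413 = `stmt-HodgeConjecture-24833`) until rung 0 closes.

## References
* [Liu2011] Y. Liu, Algebra Number Theory 5 (2011): §2B Prop. 2.3 p. 862 (absolute convergence of `Z_S` from the growth of sections).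
* [Tan1999] V. Tan, Poles of Siegel Eisenstein series on `U(n,n)`, Canad. J. Math. 51 (1999): §1 (sections of `I(s, χ)`, Iwasawa decomposition).
* [HarrisKudlaSweet1996] M. Harris, S. Kudla, W. J. Sweet, JAMS 9 (1996): (1.15)–(1.16).
* [BorelJacquet1979] A. Borel, H. Jacquet, PSPM 33.1 (1979): §4.6.
-/

set_option autoImplicit false
set_option linter.dupNamespace false

noncomputable section

open scoped InnerProductSpace ENNReal RestrictedProduct
open MeasureTheory Filter Topology

namespace Summit.HodgeConjecture.HodgeConjecture.Cruxes.HLiu418.K2LiuZetaSWeightIntegrable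

open Literature.NumberTheory.Automorphic Literature.NumberTheory.GaloisRepresentations
open Literature.NumberTheory.GelbartRogawski1991 Literature.NumberTheory.GelbartRogawski1991.GRConstruction
open Literature.NumberTheory.K2Lit.PlaceSplitting Literature.NumberTheory.K2Lit.SiegelDoubled
open Summit.HodgeConjecture.HodgeConjecture.Cruxes.HLiu418.K2LiuZetaSInnerProduct
open Summit.HodgeConjecture.HodgeConjecture.Cruxes.HLiu418.K2LiuDoublingUnfoldBridge
open Summit.HodgeConjecture.HodgeConjecture.Cruxes.HLiu418.K2LiuSiegelEisensteinDoubledSummableReduction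
open NumberField IsDedekindDomain

/-! ### §1 Growth of continuous Siegel sections along a height -/

section Growth

variable (L : Type) [Field L] [NumberField L] [IsCMField L]
variable {N M n : ℕ} (e : Fin N × Fin M ≃ Fin n)
  (dV : Fin N → L) (hdV : ∀ i, IsCMField.complexConj L (dV i) = dV i)
  (dW : Fin M → L) (hdW : ∀ i, IsCMField.complexConj L (dW i) = dW i)

/-- `‖φ(p k)‖ = modDelta(p)^{2 Re s + n} ‖φ(k)‖` for a Siegel section `φ` at `s` and `p ∈ P_Δ(𝔸)`. [cite: Tan1999, §1] -/
theorem norm_section_mul_eq {χ : HeckeCharacter L} (hχu : χ.IsUnitary) (s : ℂ) {φ : HA L e dV hdV dW hdW → ℂ}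
    (hφ : IsSiegelDeltaSection L e dV hdV dW hdW χ s φ) {p : HA L e dV hdV dW hdW} (hp : IsSiegelDelta L e dV hdV dW hdW p)
    (k : HA L e dV hdV dW hdW) :
    ‖φ (p * k)‖ = modDelta L e dV hdV dW hdW p ^ (2 * s.re + (n : ℝ)) * ‖φ k‖ := by
  rw [hφ p hp k, norm_mul, norm_siegelDeltaCharacter L e dV hdV dW hdW hχu]

/-- **Section growth along a height.** For an Iwasawa datum `𝒦` (`H(𝔸) = P_Δ(𝔸)·K`, `K` compact), a unitary `χ`, a CONTINUOUS Siegel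
section `φ` at `s`, and a continuous positive height `Φ` with `Φ(p x) = modDelta(p) Φ(x)`: `‖φ(h)‖ ≤ C · Φ(h)^{2 Re s + n}` for all `h ∈ H(𝔸)`
(write `h = p k`; `‖φ(h)‖ = (Φ(h)/Φ(k))^{2 Re s + n} ‖φ(k)‖` and `k ↦ ‖φ(k)‖ Φ(k)^{−(2 Re s + n)}` is bounded on `K`).
[cite: Liu2011, §2B Prop. 2.3 p. 862] [cite: Tan1999, §1] -/
theorem exists_norm_section_le_height_rpow (𝒦 : IwasawaDatum L e dV hdV dW hdW) {χ : HeckeCharacter L} (hχu : χ.IsUnitary)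
    (s : ℂ) {φ : HA L e dV hdV dW hdW → ℂ} (hφ : IsSiegelDeltaSection L e dV hdV dW hdW χ s φ) (hφc : Continuous φ)
    {Φ : HA L e dV hdV dW hdW → ℝ} (hΦc : Continuous Φ) (hΦpos : ∀ x, 0 < Φ x)
    (hΦ : ∀ p x : HA L e dV hdV dW hdW, IsSiegelDelta L e dV hdV dW hdW p → Φ (p * x) = modDelta L e dV hdV dW hdW p * Φ x) :
    ∃ C : ℝ, 0 ≤ C ∧ ∀ h : HA L e dV hdV dW hdW, ‖φ h‖ ≤ C * Φ h ^ (2 * s.re + (n : ℝ)) := by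
  obtain ⟨C, hC⟩ := 𝒦.isCompact_K.exists_bound_of_continuousOn
    (f := fun k : HA L e dV hdV dW hdW => ‖φ k‖ * Φ k ^ (-(2 * s.re + (n : ℝ))))
    ((hφc.norm.mul (hΦc.rpow_const fun x => Or.inl (hΦpos x).ne')).continuousOn)
  refine ⟨max C 0, le_max_right _ _, fun h => ?_⟩
  obtain ⟨p, k, hp, hk, rfl⟩ := 𝒦.iwasawa h
  have hΦk : 0 < Φ k := hΦpos k
  have hmod : modDelta L e dV hdV dW hdW p = Φ (p * k) / Φ k := by
    rw [hΦ p k hp, mul_div_cancel_right₀ _ hΦk.ne']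
  have hbd : ‖φ k‖ * Φ k ^ (-(2 * s.re + (n : ℝ))) ≤ max C 0 := by
    have h1 := hC k hk
    rw [Real.norm_of_nonneg (mul_nonneg (norm_nonneg _) (Real.rpow_nonneg hΦk.le _))] at h1
    exact h1.trans (le_max_left _ _)
  rw [norm_section_mul_eq L e dV hdV dW hdW hχu s hφ hp k, hmod, Real.div_rpow (hΦpos _).le hΦk.le,
    Real.rpow_neg hΦk.le] at *
  calc Φ (p * k) ^ (2 * s.re + (n : ℝ)) / Φ k ^ (2 * s.re + (n : ℝ)) * ‖φ k‖
      = Φ (p * k) ^ (2 * s.re + (n : ℝ)) * (‖φ k‖ * (Φ k ^ (2 * s.re + (n : ℝ)))⁻¹) := by ring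
    _ ≤ Φ (p * k) ^ (2 * s.re + (n : ℝ)) * max C 0 :=
        mul_le_mul_of_nonneg_left hbd (Real.rpow_nonneg (hΦpos _).le _)
    _ = max C 0 * Φ (p * k) ^ (2 * s.re + (n : ℝ)) := mul_comm _ _

end Growth

/-! ### §2 `L¹`-continuity of the smear (generic) -/

section Smear

variable {K : Type} [Field K] [NumberField K] (𝒢 : AdelicGroupData.{0} K) (μ : Measure 𝒢.automorphicQuotient)
  [SMulInvariantMeasure 𝒢.Adelic 𝒢.automorphicQuotient μ] {X : Type*} [MeasurableSpace X]

/-- **`‖∫ f(x) • R(p x) F dν‖ ≤ (∫ ‖f‖ dν) · ‖F‖`** (`R` is isometric): the smear `f ↦ T_f F` is `L¹ → L²([G])` continuous. [cite: BorelJacquet1979, §4.6] -/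
theorem norm_integral_smul_rightRegular_le (ν : Measure X) (p : X → 𝒢.Adelic) (f : X → ℂ) (F : 𝒢.L2 μ) :
    ‖∫ x, f x • 𝒢.rightRegular μ (p x) F ∂ν‖ ≤ (∫ x, ‖f x‖ ∂ν) * ‖F‖ := by
  calc ‖∫ x, f x • 𝒢.rightRegular μ (p x) F ∂ν‖ ≤ ∫ x, ‖f x • 𝒢.rightRegular μ (p x) F‖ ∂ν := norm_integral_le_integral_norm _
    _ = ∫ x, ‖f x‖ * ‖F‖ ∂ν := by
        refine integral_congr_ae (Eventually.of_forall fun x => ?_)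
        simp only [norm_smul, 𝒢.norm_rightRegular_apply μ]
    _ = (∫ x, ‖f x‖ ∂ν) * ‖F‖ := integral_mul_const _ _

end Smear

/-! ### §3 The doubling weight of socket #33s is `L¹` -/

section Weight

variable (L : Type) [Field L] [NumberField L] [IsCMField L]
variable {N n : ℕ} (e : Fin N × Fin 1 ≃ Fin n)
  (dV : Fin N → L) (hdV : ∀ i, IsCMField.complexConj L (dV i) = dV i)
  (dW : Fin 1 → L) (hdW : ∀ i, IsCMField.complexConj L (dW i) = dW i)
  (H : Matrix (Fin N) (Fin N) L)

/-- **`ιA` is continuous**: the socket's transport `ιA : U(H)(𝔸) →* U(diag dV)(𝔸)`, being conjugation by `toAdeleGL g` (hypothesis `_hιA`),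
agrees with a `≃ₜ*` (★ `exists_continuousMulEquiv_eq_iotaA`). [cite: PlatonovRapinchuk1994, §2.3] -/
theorem continuous_iotaA (t : L) (ht : t ≠ 0) (g : GL (Fin N) L)
    (hg : formCongr ((IsCMField.complexConj L : L ≃ₐ[↥(maximalRealSubfield L)] L) : L →+* L) g (t • H) = Matrix.diagonal dV)
    (ιA : (UnitaryGroup.adelicGroupData (Fp L) L (IsCMField.complexConj L) N H).Adelic →*
      UnitaryGroup.adelic (Fp L) L (IsCMField.complexConj L) N (Matrix.diagonal dV))
    (hιA : ∀ k, ((ιA k : ↥(UnitaryGroup.adelic (Fp L) L (IsCMField.complexConj L) N (Matrix.diagonal dV))) :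
          GL (Fin N) (AdeleRing (𝓞 L) L)) =
        (toAdeleGL L g)⁻¹ * UnitaryGroup.adelicVal (Fp L) L (IsCMField.complexConj L) N H k * toAdeleGL L g) :
    Continuous ιA := by
  obtain ⟨Ψ, -, hΨ⟩ := exists_continuousMulEquiv_eq_iotaA L H dV t ht g hg ιA hιA
  have h : (ιA : _ → _) = Ψ := funext fun x => (hΨ x).symm
  rw [h]
  exact Ψ.continuous

variable (S : Finset (HeightOneSpectrum (𝓞 (Fp L)))) [DecidableEq (HeightOneSpectrum (𝓞 (Fp L)))]
  (ιA : (UnitaryGroup.adelicGroupData (Fp L) L (IsCMField.complexConj L) N H).Adelic →*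
    UnitaryGroup.adelic (Fp L) L (IsCMField.complexConj L) N (Matrix.diagonal dV))

/-- The doubling weight `x ↦ φ(ι(ιA(p x), 1))` of a continuous `φ` is continuous on `G_∞ × G_S` (★ `continuous_iotaLeft`, ★ `continuous_placesEmbed`).
[cite: Liu2011, §2B p. 862] -/
theorem continuous_doublingWeight (hιAc : Continuous ιA) {φ : HA L e dV hdV dW hdW → ℂ} (hφc : Continuous φ) :
    Continuous fun x : UnitaryGroup.arch (Fp L) L (IsCMField.complexConj L) N H ×
        (Π v : S, UnitaryGroup.localPi L (IsCMField.complexConj L) N H v.1) =>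
      φ (iotaLeft L e dV hdV dW hdW (ιA (placesEmbed L H S x))) :=
  hφc.comp ((continuous_iotaLeft L e dV hdV dW hdW).comp (hιAc.comp (continuous_placesEmbed L H S)))

variable [MeasurableSpace (UnitaryGroup.arch (Fp L) L (IsCMField.complexConj L) N H)]
  [BorelSpace (UnitaryGroup.arch (Fp L) L (IsCMField.complexConj L) N H)]
  [∀ v : HeightOneSpectrum (𝓞 (Fp L)), MeasurableSpace (UnitaryGroup.localPi L (IsCMField.complexConj L) N H v)]
  [∀ v : HeightOneSpectrum (𝓞 (Fp L)), BorelSpace (UnitaryGroup.localPi L (IsCMField.complexConj L) N H v)]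
  (νinf : Measure (UnitaryGroup.arch (Fp L) L (IsCMField.complexConj L) N H))
  (νS : ∀ v : S, Measure (UnitaryGroup.localPi L (IsCMField.complexConj L) N H v.1))

/-- **The doubling weight is `L¹`.** For a continuous Siegel section `φ` at `s` (unitary `χ`), an Iwasawa datum, and a continuous positive
height `Φ` of type `(P_Δ, modDelta)` whose pull-back `Φ(ι(ιA ·, 1))^{2 Re s + n}` is integrable on `G_∞ × G_S`, the weight `f_φ = φ(ι(ιA ·, 1))`
is integrable on `G_∞ × G_S` (domination by ★ `exists_norm_section_le_height_rpow`). [cite: Liu2011, §2B Prop. 2.3 p. 862] -/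
theorem integrable_doublingWeight (𝒦 : IwasawaDatum L e dV hdV dW hdW) {χ : HeckeCharacter L} (hχu : χ.IsUnitary) (s : ℂ)
    {φ : HA L e dV hdV dW hdW → ℂ} (hφ : IsSiegelDeltaSection L e dV hdV dW hdW χ s φ) (hφc : Continuous φ)
    {Φ : HA L e dV hdV dW hdW → ℝ} (hΦc : Continuous Φ) (hΦpos : ∀ x, 0 < Φ x)
    (hΦ : ∀ p x : HA L e dV hdV dW hdW, IsSiegelDelta L e dV hdV dW hdW p → Φ (p * x) = modDelta L e dV hdV dW hdW p * Φ x)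
    (hιAc : Continuous ιA)
    (hdecay : Integrable (fun x => Φ (iotaLeft L e dV hdV dW hdW (ιA (placesEmbed L H S x))) ^ (2 * s.re + (n : ℝ)))
      (νinf.prod (Measure.pi νS))) :
    Integrable (fun x => φ (iotaLeft L e dV hdV dW hdW (ιA (placesEmbed L H S x)))) (νinf.prod (Measure.pi νS)) := by
  haveI := secondCountableTopology_places L H S
  haveI := borelSpace_places L H S
  haveI : OpensMeasurableSpace (UnitaryGroup.arch (Fp L) L (IsCMField.complexConj L) N H ×
      (Π v : S, UnitaryGroup.localPi L (IsCMField.complexConj L) N H v.1)) := BorelSpace.opensMeasurable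
  obtain ⟨C, -, hC⟩ := exists_norm_section_le_height_rpow L e dV hdV dW hdW 𝒦 hχu s hφ hφc hΦc hΦpos hΦ
  exact (hdecay.const_mul C).mono' (continuous_doublingWeight L e dV hdV dW hdW H S ιA hιAc hφc).aestronglyMeasurable
    (Eventually.of_forall fun x => hC _)

/-- **In the socket's currency.** With `e : Fin N × Fin 1 ≃ Fin n` (so `n = N`), `N/2 − 1 < Re s₀` and the sharp decay
`∀ τ > 2N − 2, Φ(ι(ιA ·, 1))^τ ∈ L¹(G_∞ × G_S)` (socket binders `_hs₀`, `_hdecay`), the exponent `2 Re s₀ + n > 2N − 2` is admissible, so the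
doubling weight of every continuous Siegel section at `s₀` is `L¹`. [cite: Liu2011, §2B Prop. 2.3 p. 862] -/
theorem integrable_doublingWeight_of_decay (𝒦 : IwasawaDatum L e dV hdV dW hdW) {χ : HeckeCharacter L} (hχu : χ.IsUnitary)
    {s₀ : ℂ} (hs₀ : (N : ℝ) / 2 - 1 < s₀.re)
    {φ : HA L e dV hdV dW hdW → ℂ} (hφ : IsSiegelDeltaSection L e dV hdV dW hdW χ s₀ φ) (hφc : Continuous φ)
    {Φ : HA L e dV hdV dW hdW → ℝ} (hΦc : Continuous Φ) (hΦpos : ∀ x, 0 < Φ x)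
    (hΦ : ∀ p x : HA L e dV hdV dW hdW, IsSiegelDelta L e dV hdV dW hdW p → Φ (p * x) = modDelta L e dV hdV dW hdW p * Φ x)
    (hιAc : Continuous ιA)
    (hdecay : ∀ τ : ℝ, 2 * (N : ℝ) - 2 < τ →
      Integrable (fun x => Φ (iotaLeft L e dV hdV dW hdW (ιA (placesEmbed L H S x))) ^ τ) (νinf.prod (Measure.pi νS))) :
    Integrable (fun x => φ (iotaLeft L e dV hdV dW hdW (ιA (placesEmbed L H S x)))) (νinf.prod (Measure.pi νS)) := by
  refine integrable_doublingWeight L e dV hdV dW hdW H S ιA νinf νS 𝒦 hχu s₀ hφ hφc hΦc hΦpos hΦ hιAc (hdecay _ ?_)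
  have hn : (n : ℝ) = N := by exact_mod_cast (show n = N by simpa using (Fintype.card_congr e).symm)
  rw [hn]
  linarith

variable (μ : Measure (UnitaryGroup.adelicGroupData (Fp L) L (IsCMField.complexConj L) N H).automorphicQuotient)
  [(UnitaryGroup.adelicGroupData (Fp L) L (IsCMField.complexConj L) N H).IsAutomorphicMeasure μ]
  [CompactSpace (UnitaryGroup.adelicGroupData (Fp L) L (IsCMField.complexConj L) N H).automorphicQuotient]

/-- **O33.2 + O33.3.** For a continuous Siegel section `φ` at `s₀` (unitary `χ`, an Iwasawa datum, a height `Φ` with the socket's sharp decay,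
`N/2 − 1 < Re s₀`) and a continuous `φ₁` on the compact quotient `[G]`: if the smear `T_{f_φ}[φ₁] = ∫ f_φ(x) • R(p x)[φ₁]` is NON-ZERO in
`L²([G])`, then `Z_S(φ, φ₁, φ₁(g₀ • ·)) ≠ 0` for some `g₀ ∈ G(𝔸)` (★ `exists_zetaS_translate_ne_zero_of_continuous` with its `L¹` hypothesis
discharged by `integrable_doublingWeight_of_decay`). [cite: Liu2011, §2B Prop. 2.3 p. 862] -/
theorem exists_zetaS_translate_ne_zero_of_section (𝒦 : IwasawaDatum L e dV hdV dW hdW) {χ : HeckeCharacter L} (hχu : χ.IsUnitary)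
    {s₀ : ℂ} (hs₀ : (N : ℝ) / 2 - 1 < s₀.re)
    {φ : HA L e dV hdV dW hdW → ℂ} (hφ : IsSiegelDeltaSection L e dV hdV dW hdW χ s₀ φ) (hφc : Continuous φ)
    {Φ : HA L e dV hdV dW hdW → ℝ} (hΦc : Continuous Φ) (hΦpos : ∀ x, 0 < Φ x)
    (hΦ : ∀ p x : HA L e dV hdV dW hdW, IsSiegelDelta L e dV hdV dW hdW p → Φ (p * x) = modDelta L e dV hdV dW hdW p * Φ x)
    (hιAc : Continuous ιA)
    (hdecay : ∀ τ : ℝ, 2 * (N : ℝ) - 2 < τ →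
      Integrable (fun x => Φ (iotaLeft L e dV hdV dW hdW (ιA (placesEmbed L H S x))) ^ τ) (νinf.prod (Measure.pi νS)))
    {φ₁ : (UnitaryGroup.adelicGroupData (Fp L) L (IsCMField.complexConj L) N H).automorphicQuotient → ℂ} (hφ₁ : Continuous φ₁)
    (hne : (∫ x, φ (iotaLeft L e dV hdV dW hdW (ιA (placesEmbed L H S x))) •
          (UnitaryGroup.adelicGroupData (Fp L) L (IsCMField.complexConj L) N H).rightRegular μ (placesEmbed L H S x)
            ((memLp_two_of_continuous _ μ hφ₁).toLp φ₁)
        ∂(νinf.prod (Measure.pi νS))) ≠ 0) :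
    ∃ g₀ : (UnitaryGroup.adelicGroupData (Fp L) L (IsCMField.complexConj L) N H).Adelic,
      zetaS L e dV hdV dW hdW H S νinf νS μ ιA φ φ₁ (fun y => φ₁ (g₀ • y)) ≠ 0 :=
  exists_zetaS_translate_ne_zero_of_continuous L e dV hdV dW hdW H S νinf νS μ ιA φ hφ₁
    (integrable_doublingWeight_of_decay L e dV hdV dW hdW H S ιA νinf νS 𝒦 hχu hs₀ hφ hφc hΦc hΦpos hΦ hιAc hdecay) hne

end Weight

end Summit.HodgeConjecture.HodgeConjecture.Cruxes.HLiu418.K2LiuZetaSWeightIntegrable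

end
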